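import Mathlib
import Summits.AtomisticToContinuum.HydrodynamicLimit.Theses.CollisionIsometryCLT

/-!
# Crux `DiffuseBackwardInfluence` (stmt-AtomisticToContinuum-12950) — crux-ideate round 1, ideator 1 (gen 2)

Typed first lemmas / transfer targets of the three idea cards of this seat
(`idea-relay-cascade-bfk.md`, `idea-share-nondegeneracy-one-flight.md`,
`idea-caged-stratum-pricing.md`). Nothing here restates or weakens the crux; the crux decl is
`Summit.AtomisticToContinuum.HydrodynamicLimit.Theses.CollisionIsometryCLT.DiffuseBackwardInfluence`.

Contents
* §0 the crux's frozen-geometry transfer after the first `n` collisions of the Alexander dynamics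
  (`transferN`, verbatim the crux's `let M` with the collision count replaced by `n`), block masses
  `blockMass` (= ‖M_ik‖_F²) and shares `blockShare` (= ωᵀ M_ik M_ikᵀ ω), the `n`-th collision's pair and
  unit normal.
* §1 (card relay-cascade-bfk) the abstract one-source exchange process, the exact exchange identity,
  the collector bound, the BFK fact `BFKFreeSpaceCollisionBound` (Burago–Ferleger–Kononenko 1998) and the
  typed core conjecture `CascadeCore`.
* §2 (card share-nondegeneracy-one-flight) the band/cap inclusion lemmas for degenerate shares
  (PROVED) and the typed first target `ShareNonDegeneracyRatio` over the Alexander construction.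
* §3 (card caged-stratum-pricing) the coordinate-normal no-split kernel (reflection with a coordinate
  normal swaps one scalar component: PROVED; the fold statement as target) and the statics pricing
  target `TouchingPairsLD`.
-/

namespace Summit.AtomisticToContinuum.HydrodynamicLimit.Cruxes.DiffuseBackwardInfluence.IdeatorOneG2

open scoped BigOperators InnerProductSpace ENNReal
open MeasureTheory Filter Topology Set

noncomputable section

/-- Velocity space. -/
abbrev V3 : Type := EuclideanSpace ℝ (Fin 3)

/-- Torus phase space of `N + 1` spheres. -/
abbrev Cfg (N : ℕ) : Type :=
  Literature.Analysis.FluidPDE.Config (N + 1) (Fin 3) (UnitAddTorus (Fin 3))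

/-! ## §0 The transfer after `n` collisions (the crux's `let M`, step count made explicit) -/

section Transfer

variable (σ : ℝ) (N : ℕ)

/-- Pre-collisional configuration of the `n`-th collision of the Alexander dynamics started at `y`
(the crux's `pre k`). -/
def pre (y : Cfg N) (n : ℕ) : Cfg N :=
  let G := Literature.Analysis.FluidPDE.Torus.geometry (Fin 3)
  let ε : ℝ := Literature.MathematicalPhysics.KineticTheory.hsDiameter σ N
  let zk := Literature.Analysis.FluidPDE.Alexander.stateAfter G ε y n
  Literature.Analysis.FluidPDE.freeFlight G
    (Literature.Analysis.FluidPDE.Alexander.freeExitTime G ε zk).toReal zk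

/-- The frozen-geometry velocity transfer after the first `n` collisions: fold of the linear
collision reflections at the realised pre-collisional positions (the crux's `M N y Δ` is
`transferN σ N y (collisionCount … y Δ)`). -/
def transferN (y : Cfg N) (n : ℕ) (W : Fin (N + 1) → V3) : Fin (N + 1) → V3 :=
  let G := Literature.Analysis.FluidPDE.Torus.geometry (Fin 3)
  let ε : ℝ := Literature.MathematicalPhysics.KineticTheory.hsDiameter σ N
  (List.range n).foldl
    (fun W' k =>
      @dite (Fin (N + 1) → V3)
        (Literature.Analysis.FluidPDE.Alexander.incomingPairs G ε (pre σ N y k)).Nonempty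
        (Classical.propDecidable _)
        (fun h => fun i =>
          (Literature.Analysis.FluidPDE.collidePair G h.some.1 h.some.2
            (fun j => ((pre σ N y k j).1, W' j)) i).2)
        (fun _ => W'))
    W

/-- The transfer over the window `[0, Δ]` (all collisions up to time `Δ`): the crux's `M N y Δ`. -/
def transferWin (y : Cfg N) (Δ : ℝ) (W : Fin (N + 1) → V3) : Fin (N + 1) → V3 :=
  transferN σ N y
    (Literature.Analysis.FluidPDE.Alexander.collisionCount
      (Literature.Analysis.FluidPDE.Torus.geometry (Fin 3))
      (Literature.MathematicalPhysics.KineticTheory.hsDiameter σ N) y Δ) W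

/-- The `a`-th column of the block `M_ik` after `n` collisions: the image at particle `i` of the
basis field `e_k ⊗ e_a`. -/
def blockCol (y : Cfg N) (n : ℕ) (i k : Fin (N + 1)) (a : Fin 3) : V3 :=
  transferN σ N y n (Pi.single k (EuclideanSpace.single a (1 : ℝ))) i

/-- Block mass `a_ik(n) = ‖M_ik‖_F² = Σ_a ‖M_ik e_a‖²` (row budget `Σ_k a_ik = 3`; the crux's `ipr`
is `(N+1)⁻¹ Σ_i Σ_k a_ik²` at `n = collisionCount`). -/
def blockMass (y : Cfg N) (n : ℕ) (i k : Fin (N + 1)) : ℝ :=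
  ∑ a : Fin 3, ‖blockCol σ N y n i k a‖ ^ 2

/-- Share of the block `M_ik` along a direction `ω`: `ωᵀ (M_ik M_ikᵀ) ω = Σ_a ⟪ω, M_ik e_a⟫²` — the
mass particle `i` hands over (for source `k`) in a collision with unit normal `ω`. -/
def blockShare (y : Cfg N) (n : ℕ) (i k : Fin (N + 1)) (ω : V3) : ℝ :=
  ∑ a : Fin 3, ⟪ω, blockCol σ N y n i k a⟫_ℝ ^ 2

/-- The colliding pair of the `n`-th collision (`none` on the null set where no incoming contact pair
is present at the exit point). -/
def stepPair (y : Cfg N) (n : ℕ) : Option (Fin (N + 1) × Fin (N + 1)) :=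
  let G := Literature.Analysis.FluidPDE.Torus.geometry (Fin 3)
  let ε : ℝ := Literature.MathematicalPhysics.KineticTheory.hsDiameter σ N
  @dite (Option (Fin (N + 1) × Fin (N + 1)))
    (Literature.Analysis.FluidPDE.Alexander.incomingPairs G ε (pre σ N y n)).Nonempty
    (Classical.propDecidable _) (fun h => some h.some) (fun _ => none)

/-- The unit normal `ω_n = (x_i − x_j)/ε` of the `n`-th collision (minimal-image separation; `0` as junk). -/
def stepNormal (y : Cfg N) (n : ℕ) : V3 :=
  match stepPair σ N y n with
  | some p =>
      let s := (Literature.Analysis.FluidPDE.Torus.geometry (Fin 3)).sepVec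
        ((pre σ N y n) p.1).1 ((pre σ N y n) p.2).1
      ‖s‖⁻¹ • s
  | none => 0

end Transfer

/-! ## §1 Card `relay-cascade-bfk`: the abstract exchange process, the exchange identity, BFK -/

section Cascade

/-- One step of the abstract one-source exchange process on `n` particles: particles `i ≠ j` collide,
`i` hands over `e` (its share along the normal), `j` hands over `w`. In the hard-sphere instance
`e = blockShare … i k ω`, `w = blockShare … j k ω`. -/
structure ExchangeStep (n : ℕ) where
  i : Fin n
  j : Fin n
  e : ℝ
  w : ℝ

/-- Masses after one step: `a_i ↦ a_i − e + w`, `a_j ↦ a_j − w + e` (exact, from `(I−P)M_ik + P M_jk`,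
cross terms vanish because `(I−P)P = 0`). -/
def applyStep {n : ℕ} (a : Fin n → ℝ) (s : ExchangeStep n) : Fin n → ℝ :=
  Function.update (Function.update a s.i (a s.i - s.e + s.w)) s.j (a s.j - s.w + s.e)

/-- Masses after a list of steps. -/
def massesAfter {n : ℕ} (a : Fin n → ℝ) (L : List (ExchangeStep n)) : Fin n → ℝ :=
  L.foldl applyStep a

/-- Masses just before the `m`-th step of `L`. -/
def massesBefore {n : ℕ} (a : Fin n → ℝ) (L : List (ExchangeStep n)) (m : ℕ) : Fin n → ℝ :=
  massesAfter a (L.take m)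

/-- Admissibility of a history: distinct endpoints, and nobody hands over more than it has or less
than nothing (`0 ≤ e ≤ a_i`, `0 ≤ w ≤ a_j` before the step). -/
def Admissible {n : ℕ} (a : Fin n → ℝ) (L : List (ExchangeStep n)) : Prop :=
  ∀ m (hm : m < L.length),
    let s := L.get ⟨m, hm⟩
    let b := massesBefore a L m
    s.i ≠ s.j ∧ 0 ≤ s.e ∧ s.e ≤ b s.i ∧ 0 ≤ s.w ∧ s.w ≤ b s.j

/-- Two-sided share non-degeneracy with margin `c₀` at every step, for both endpoints:
`c₀ a_i ≤ e ≤ (1−c₀) a_i` and `c₀ a_j ≤ w ≤ (1−c₀) a_j`. (In the hard-sphere instance this is the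
hypothesis delivered by card `share-nondegeneracy-one-flight`, there only for all but a controlled
number of heavy steps.) -/
def FullyNonDegenerate {n : ℕ} (c₀ : ℝ) (a : Fin n → ℝ) (L : List (ExchangeStep n)) : Prop :=
  ∀ m (hm : m < L.length),
    let s := L.get ⟨m, hm⟩
    let b := massesBefore a L m
    c₀ * b s.i ≤ s.e ∧ s.e ≤ (1 - c₀) * b s.i ∧ c₀ * b s.j ≤ s.w ∧ s.w ≤ (1 - c₀) * b s.j

/-- BFK-type locality of the step sequence (the abstract shadow of Burago–Ferleger–Kononenko): for
every particle set `S`, every contiguous block of steps `[m₁, m₂)` containing no step between `S` and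
`Sᶜ` contains at most `C S.card` steps with both endpoints in `S`. -/
def LocalityBFK {n : ℕ} (C : ℕ → ℕ) (L : List (ExchangeStep n)) : Prop :=
  ∀ (S : Finset (Fin n)) (m₁ m₂ : ℕ), m₁ ≤ m₂ → m₂ ≤ L.length →
    (∀ m (hm : m < L.length), m₁ ≤ m → m < m₂ →
      ((L.get ⟨m, hm⟩).i ∈ S ↔ (L.get ⟨m, hm⟩).j ∈ S)) →
    ((Finset.range L.length).filter (fun m => m₁ ≤ m ∧ m < m₂ ∧
        ∃ hm : m < L.length, (L.get ⟨m, hm⟩).i ∈ S ∧ (L.get ⟨m, hm⟩).j ∈ S)).card ≤ C S.card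

/-- Number of steps of `L` with endpoint `i`. -/
def stepsOf {n : ℕ} (L : List (ExchangeStep n)) (i : Fin n) : ℕ :=
  (L.filter (fun s => decide (s.i = i ∨ s.j = i))).length

/-- **Typed core conjecture of card `relay-cascade-bfk` (`CascadeCore`).** In the fully
non-degenerate abstract exchange process with BFK-type locality, universal activity forces
ℓ²-delocalisation UNIFORMLY IN THE NUMBER OF PARTICLES: for every margin `c₀ ∈ (0, 1/3)`, every
locality function `C` and every `η > 0` there is `m₀` such that, for every `n`, every nonnegative
initial mass vector of total mass `3` and every admissible, fully `c₀`-non-degenerate, `C`-local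
history in which every particle takes at least `m₀` steps, the final masses satisfy `Σ_i a_i² ≤ η`.
(The hard-sphere line uses the refinement with a bounded number of degenerate heavy steps and an
exceptional collision-poor set; kit-falsifiable by adversarial search over histories.) -/
def CascadeCore : Prop :=
  ∀ c₀ : ℝ, 0 < c₀ → c₀ < 1 / 3 → ∀ C : ℕ → ℕ, ∀ η : ℝ, 0 < η → ∃ m₀ : ℕ,
    ∀ (n : ℕ) (a : Fin n → ℝ) (L : List (ExchangeStep n)),
      (∀ i, 0 ≤ a i) → ∑ i, a i = 3 → Admissible a L → FullyNonDegenerate c₀ a L →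
      LocalityBFK C L → (∀ i, m₀ ≤ stepsOf L i) →
      ∑ i, (massesAfter a L i) ^ 2 ≤ η

/-- **The exchange identity** (exact): if `i` hands over net `t = e − w` to `j`, then
`Δ(a_i² + a_j²) = −2 t ((a_i − a_j) − t)`; it is `≤ 0` iff the transfer goes from richer to poorer
without overshooting the gap. -/
theorem exchange_sq_identity (ai aj t : ℝ) :
    (ai - t) ^ 2 + (aj + t) ^ 2 - (ai ^ 2 + aj ^ 2) = -2 * t * ((ai - aj) - t) := by
  ring

/-- Forced decrease: a two-sided `c₀`-non-degenerate step between a heavy `i` and a much lighter `j`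
(`(1 − c₀) a_j < c₀ a_i`) strictly lowers `a_i² + a_j²`, by at least `2 (c₀ a_i − (1−c₀) a_j)²`. -/
theorem exchange_sq_decrease {ai aj e w c₀ : ℝ}
    (he₁ : c₀ * ai ≤ e) (he₂ : e ≤ (1 - c₀) * ai) (hw₁ : c₀ * aj ≤ w) (hw₂ : w ≤ (1 - c₀) * aj) :
    (ai - e + w) ^ 2 + (aj - w + e) ^ 2 - (ai ^ 2 + aj ^ 2) ≤
      -2 * (c₀ * ai - (1 - c₀) * aj) ^ 2 ∨ c₀ * ai ≤ (1 - c₀) * aj := by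
  by_cases h : c₀ * ai ≤ (1 - c₀) * aj
  · exact Or.inr h
  · left
    push Not at h
    have key : (ai - e + w) ^ 2 + (aj - w + e) ^ 2 - (ai ^ 2 + aj ^ 2) =
        -2 * (e - w) * ((ai - aj) - (e - w)) := by ring
    rw [key]
    have h1 : c₀ * ai - (1 - c₀) * aj ≤ e - w := by linarith
    have h2 : c₀ * ai - (1 - c₀) * aj ≤ (ai - aj) - (e - w) := by linarith
    have h0 : 0 ≤ c₀ * ai - (1 - c₀) * aj := by linarith
    nlinarith [mul_le_mul h1 h2 h0 (h0.trans h1)]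

/-- **Collector bound** (one step): under two-sided non-degeneracy a particle keeps at most `1 − c₀`
of its own mass and takes at most `1 − c₀` of its partner's: `a_i' ≤ (1−c₀)(a_i + a_j)`. Iterated along
`s` steps against partners of mass `≤ m` this gives `a ≤ (1−c₀)^s a₀ + m (1−c₀)/c₀`: a mass-holder
decays geometrically unless fed by comparably heavy partners (the clique that BFK then starves). -/
theorem collector_step {ai aj e w c₀ : ℝ} (he₁ : c₀ * ai ≤ e) (hw₂ : w ≤ (1 - c₀) * aj) :
    ai - e + w ≤ (1 - c₀) * (ai + aj) := by
  nlinarith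

/-- Iterated collector bound along `s` steps with partners of mass at most `m` (pure real-analysis
statement; first lemma of the relay bookkeeping). -/
theorem collector_iterate (c₀ m : ℝ) (hc₀ : 0 < c₀) (hc₁ : c₀ ≤ 1) (hm : 0 ≤ m)
    (x : ℕ → ℝ) (hx : ∀ s, x (s + 1) ≤ (1 - c₀) * (x s + m)) (s : ℕ) :
    x s ≤ (1 - c₀) ^ s * x 0 + m * (1 - c₀) / c₀ := by
  induction s with
  | zero =>
    simp only [pow_zero, one_mul, le_add_iff_nonneg_right]
    have : 0 ≤ 1 - c₀ := by linarith
    positivity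
  | succ s ih =>
    have h1c : 0 ≤ 1 - c₀ := by linarith
    calc x (s + 1) ≤ (1 - c₀) * (x s + m) := hx s
      _ ≤ (1 - c₀) * ((1 - c₀) ^ s * x 0 + m * (1 - c₀) / c₀ + m) := by gcongr
      _ = (1 - c₀) ^ (s + 1) * x 0 + m * (1 - c₀) / c₀ := by
          field_simp
          ring

/-- **Fact (Burago–Ferleger–Kononenko 1998, Ann. Math. 147, 695–708, main theorem and its hard-ball
corollary; theorem number to be read off the paper, not held on this hub): uniform bound on the number
of collisions of `K` hard balls in free space.** For every `K` there is `C(K)` such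
that every hard-sphere trajectory of `K` spheres of (any) diameter `ε` in `ℝ³` has at most `C(K)`
collisions on every time interval (equal masses; finiteness: Vaserstein 1979, Illner 1989; uniformity:
BFK; `C(K)` may grow like `K^{K²}` and exponentially many collisions do occur, Burago–Ivanov 2018). Used
by card `relay-cascade-bfk` as a LEAKAGE generator: between two consecutive contacts of a particle set
`S` with its complement, `S` evolves as a free `|S|`-ball system, so internal traffic is
`≤ C(|S|)·(external traffic + 1)`. [cite: BFK1998, main theorem] [cite: arXiv:1605.00607, §1.2] -/
def BFKFreeSpaceCollisionBound : Prop :=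
  ∀ K : ℕ, ∃ C : ℕ, ∀ ε : ℝ, 0 < ε →
    ∀ γ : ℝ → Literature.Analysis.FluidPDE.Config K (Fin 3) (EuclideanSpace ℝ (Fin 3)),
      Literature.Analysis.FluidPDE.IsHardSphereTrajectory
          (Literature.Analysis.FluidPDE.Euclidean.geometry (Fin 3)) ε K γ →
        ∀ a b : ℝ,
          Literature.Analysis.FluidPDE.numCollisions
            (Literature.Analysis.FluidPDE.Euclidean.geometry (Fin 3)) ε γ a b ≤ C

end Cascade

/-! ## §2 Card `share-nondegeneracy-one-flight`: degenerate shares live in a band or a cap -/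

section Band

/-- **Band inclusion (PROVED).** If the share of a block along the unit normal `ω` is below the
fraction `c₀` of its mass, `Σ_a ⟪ω, u_a⟫² < c₀ Σ_a ‖u_a‖²`, then `ω` lies in the band of half-width
`√(3c₀)` around the great circle orthogonal to the LONGEST column `u_{a*}` of the block — a direction
determined by the block alone (no spectral theorem: pigeonhole on the three columns). With the tree's
`toSphere_band_le` (PostCollisionGeometry) the band has normalised measure `O(√c₀)` under any law on
`S²` with bounded density. -/
theorem inner_sq_lt_of_share_lt {c₀ : ℝ} {ω : V3} {u : Fin 3 → V3} {a₀ : Fin 3}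
    (hmax : ∀ a, ‖u a‖ ≤ ‖u a₀‖)
    (hshare : ∑ a, ⟪ω, u a⟫_ℝ ^ 2 < c₀ * ∑ a, ‖u a‖ ^ 2) :
    ⟪ω, u a₀⟫_ℝ ^ 2 < 3 * c₀ * ‖u a₀‖ ^ 2 := by
  have h1 : ⟪ω, u a₀⟫_ℝ ^ 2 ≤ ∑ a, ⟪ω, u a⟫_ℝ ^ 2 :=
    Finset.single_le_sum (f := fun a => ⟪ω, u a⟫_ℝ ^ 2) (fun a _ => sq_nonneg _)
      (Finset.mem_univ a₀)
  have h2 : ∑ a, ‖u a‖ ^ 2 ≤ 3 * ‖u a₀‖ ^ 2 := by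
    calc ∑ a, ‖u a‖ ^ 2 ≤ ∑ _a : Fin 3, ‖u a₀‖ ^ 2 :=
          Finset.sum_le_sum fun a _ => by
            have := hmax a
            have h0 : 0 ≤ ‖u a‖ := norm_nonneg _
            nlinarith
      _ = 3 * ‖u a₀‖ ^ 2 := by simp [Finset.sum_const, Finset.card_univ]
  rcases lt_or_ge 0 c₀ with hc | hc
  · calc ⟪ω, u a₀⟫_ℝ ^ 2 ≤ ∑ a, ⟪ω, u a⟫_ℝ ^ 2 := h1
      _ < c₀ * ∑ a, ‖u a‖ ^ 2 := hshare
      _ ≤ c₀ * (3 * ‖u a₀‖ ^ 2) := by gcongr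
      _ = 3 * c₀ * ‖u a₀‖ ^ 2 := by ring
  · exfalso
    have hs : 0 ≤ ∑ a, ⟪ω, u a⟫_ℝ ^ 2 := Finset.sum_nonneg fun a _ => sq_nonneg _
    have ht : c₀ * ∑ a, ‖u a‖ ^ 2 ≤ 0 :=
      mul_nonpos_of_nonpos_of_nonneg hc (Finset.sum_nonneg fun a _ => sq_nonneg _)
    linarith

/-- **Cap inclusion (PROVED).** If the share exceeds the fraction `1 − c₀` of the mass and `‖ω‖ ≤ 1`,
then `ω` is within the cap `⟪ω, u_{a*}⟫² > (1 − 3c₀)‖u_{a*}‖²` around the longest column (a block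
handing over almost everything is almost rank one with the normal along its axis). -/
theorem inner_sq_gt_of_share_gt {c₀ : ℝ} {ω : V3} {u : Fin 3 → V3} {a₀ : Fin 3}
    (hω : ‖ω‖ ≤ 1) (hmax : ∀ a, ‖u a‖ ≤ ‖u a₀‖)
    (hshare : (1 - c₀) * ∑ a, ‖u a‖ ^ 2 < ∑ a, ⟪ω, u a⟫_ℝ ^ 2) :
    (1 - 3 * c₀) * ‖u a₀‖ ^ 2 < ⟪ω, u a₀⟫_ℝ ^ 2 := by
  -- Cauchy–Schwarz termwise: ⟪ω, u a⟫² ≤ ‖u a‖²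
  have hcs : ∀ a, ⟪ω, u a⟫_ℝ ^ 2 ≤ ‖u a‖ ^ 2 := fun a => by
    have h := abs_real_inner_le_norm ω (u a)
    have h' : |⟪ω, u a⟫_ℝ| ≤ ‖u a‖ := by
      calc |⟪ω, u a⟫_ℝ| ≤ ‖ω‖ * ‖u a‖ := h
        _ ≤ 1 * ‖u a‖ := by gcongr
        _ = ‖u a‖ := one_mul _
    calc ⟪ω, u a⟫_ℝ ^ 2 = |⟪ω, u a⟫_ℝ| ^ 2 := (sq_abs _).symm
      _ ≤ ‖u a‖ ^ 2 := by
          have h0 : 0 ≤ |⟪ω, u a⟫_ℝ| := abs_nonneg _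
          nlinarith
  -- deficits d_a = ‖u a‖² − ⟪ω,u a⟫² ≥ 0 sum to < c₀ Σ‖u a‖² ≤ 3 c₀ ‖u a₀‖²
  have hdef : ∑ a, (‖u a‖ ^ 2 - ⟪ω, u a⟫_ℝ ^ 2) < c₀ * ∑ a, ‖u a‖ ^ 2 := by
    rw [Finset.sum_sub_distrib]; linarith
  have hsingle : ‖u a₀‖ ^ 2 - ⟪ω, u a₀⟫_ℝ ^ 2 ≤ ∑ a, (‖u a‖ ^ 2 - ⟪ω, u a⟫_ℝ ^ 2) :=
    Finset.single_le_sum (f := fun a => ‖u a‖ ^ 2 - ⟪ω, u a⟫_ℝ ^ 2)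
      (fun a _ => sub_nonneg.2 (hcs a)) (Finset.mem_univ a₀)
  have h2 : ∑ a, ‖u a‖ ^ 2 ≤ 3 * ‖u a₀‖ ^ 2 := by
    calc ∑ a, ‖u a‖ ^ 2 ≤ ∑ _a : Fin 3, ‖u a₀‖ ^ 2 :=
          Finset.sum_le_sum fun a _ => by
            have := hmax a
            have h0 : 0 ≤ ‖u a‖ := norm_nonneg _
            nlinarith
      _ = 3 * ‖u a₀‖ ^ 2 := by simp [Finset.sum_const, Finset.card_univ]
  rcases lt_or_ge 0 c₀ with hc | hc
  · have : c₀ * ∑ a, ‖u a‖ ^ 2 ≤ c₀ * (3 * ‖u a₀‖ ^ 2) := by gcongr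
    nlinarith
  · -- c₀ ≤ 0: the hypothesis is impossible since shares never exceed masses
    exfalso
    have hle : ∑ a, ⟪ω, u a⟫_ℝ ^ 2 ≤ ∑ a, ‖u a‖ ^ 2 := Finset.sum_le_sum fun a _ => hcs a
    have hnn : 0 ≤ ∑ a, ‖u a‖ ^ 2 := Finset.sum_nonneg fun a _ => sq_nonneg _
    nlinarith

end Band

/-! ### The typed first target of card `share-nondegeneracy-one-flight` -/

section ShareND

variable (σ : ℝ) (N : ℕ)

/-- The `(n, k)`-incidence "the `n`-th collision involves a particle whose `k`-block is `θ`-heavy" . -/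
def heavyIncidence (y : Cfg N) (θ : ℝ) (n : ℕ) (k : Fin (N + 1)) : Prop :=
  match stepPair σ N y n with
  | some p => θ ≤ blockMass σ N y n p.1 k ∨ θ ≤ blockMass σ N y n p.2 k
  | none => False

/-- … and is DEGENERATE with margin `c₀` for that heavy endpoint: its share along the realised normal is
outside `[c₀ a, (1 − c₀) a]`. -/
def degenerateIncidence (y : Cfg N) (c₀ θ : ℝ) (n : ℕ) (k : Fin (N + 1)) : Prop :=
  match stepPair σ N y n with
  | some p =>
      (θ ≤ blockMass σ N y n p.1 k ∧
        (blockShare σ N y n p.1 k (stepNormal σ N y n) < c₀ * blockMass σ N y n p.1 k ∨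
          (1 - c₀) * blockMass σ N y n p.1 k < blockShare σ N y n p.1 k (stepNormal σ N y n))) ∨
      (θ ≤ blockMass σ N y n p.2 k ∧
        (blockShare σ N y n p.2 k (stepNormal σ N y n) < c₀ * blockMass σ N y n p.2 k ∨
          (1 - c₀) * blockMass σ N y n p.2 k < blockShare σ N y n p.2 k (stepNormal σ N y n)))
  | none => False

open Classical in
/-- Number of `θ`-heavy incidences in the window `[0, Δ]`. -/
def heavyCount (y : Cfg N) (Δ θ : ℝ) : ℕ :=
  let cc := Literature.Analysis.FluidPDE.Alexander.collisionCount
    (Literature.Analysis.FluidPDE.Torus.geometry (Fin 3))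
    (Literature.MathematicalPhysics.KineticTheory.hsDiameter σ N) y Δ
  ((Finset.range cc ×ˢ (Finset.univ : Finset (Fin (N + 1)))).filter
    (fun p => heavyIncidence σ N y θ p.1 p.2)).card

open Classical in
/-- Number of degenerate `θ`-heavy incidences in the window `[0, Δ]`. -/
def degenerateCount (y : Cfg N) (Δ c₀ θ : ℝ) : ℕ :=
  let cc := Literature.Analysis.FluidPDE.Alexander.collisionCount
    (Literature.Analysis.FluidPDE.Torus.geometry (Fin 3))
    (Literature.MathematicalPhysics.KineticTheory.hsDiameter σ N) y Δ
  ((Finset.range cc ×ˢ (Finset.univ : Finset (Fin (N + 1)))).filter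
    (fun p => degenerateIncidence σ N y c₀ θ p.1 p.2)).card

/-- **Typed first target of card `share-nondegeneracy-one-flight` (`ShareNonDegeneracyRatio`).**
Along the local-Gibbs-evolved law, on every admissible window, among the `θ`-heavy
(collision, source)-incidences the two-sided `c₀`-DEGENERATE ones (share outside `[c₀ a, (1−c₀) a]`,
i.e. realised normal in the `√(3c₀)`-band or `√(3c₀)`-cap of the heavy block, by
`inner_sq_lt_of_share_lt` / `inner_sq_gt_of_share_gt`) are at most a `K(σ)·√c₀` fraction in mean,
uniformly in `N` (unconditional "Palm fraction" form; the line needs its filtered version —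
conditional on a coarse past — which this statement is the first falsifiable shadow of). -/
def ShareNonDegeneracyRatio : Prop :=
  ∀ (a₀ θ₀ : UnitAddTorus (Fin 3) → ℝ) (u₀ : UnitAddTorus (Fin 3) → V3),
    Continuous a₀ → Continuous θ₀ → Continuous u₀ → (∀ x, 0 < a₀ x) → (∀ x, 0 < θ₀ x) →
    ∃ σ₀ : ℝ, 0 < σ₀ ∧ ∀ σ : ℝ, 0 < σ → σ < σ₀ → ∃ K : ℝ, 0 < K ∧
      ∀ Φ : (N : ℕ) → Literature.Analysis.FluidPDE.HardSphereFlow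
          (Literature.Analysis.FluidPDE.Torus.geometry (Fin 3))
          (Literature.MathematicalPhysics.KineticTheory.hsDiameter σ N) (N + 1),
      ∀ Δ : ℕ → ℝ, (∀ N, 0 < Δ N) → Tendsto Δ atTop (𝓝 0) →
        Tendsto (fun N : ℕ => Δ N * ((N + 1 : ℕ) : ℝ) ^ ((1 : ℝ) / 3)) atTop atTop →
      ∀ t : ℝ, 0 < t → ∀ c₀ : ℝ, 0 < c₀ → c₀ < 1 / 3 → ∀ θ : ℝ, 0 < θ →
        Filter.limsup
          (fun N : ℕ =>
            (∫⁻ z, (degenerateCount σ N ((Φ N).flow (t - Δ N) z) (Δ N) c₀ θ : ℝ≥0∞)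
                ∂(Literature.MathematicalPhysics.KineticTheory.localGibbsLaw σ a₀ u₀ θ₀ N (Φ N))) /
            ((∫⁻ z, (heavyCount σ N ((Φ N).flow (t - Δ N) z) (Δ N) θ : ℝ≥0∞)
                ∂(Literature.MathematicalPhysics.KineticTheory.localGibbsLaw σ a₀ u₀ θ₀ N (Φ N))) +
              ((N + 1 : ℕ) : ℝ≥0∞)))
          atTop ≤ ENNReal.ofReal (K * Real.sqrt c₀)

end ShareND

/-! ## §3 Card `caged-stratum-pricing`: the coordinate-normal no-split kernel and the statics price -/

section Cage

/-- Reflection with a COORDINATE normal swaps exactly one scalar component of the two velocities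
(`v'_b = w_b`, `w'_b = v_b`, all other components unchanged) — PROVED. Hence with all normals in
`{±e_b}` (hard rods, an exactly cubic cage) the transfer permutes the `3(N+1)` scalar coordinates and
every block mass is an INTEGER, so `ipr_i = Σ_k a_ik² ≥ Σ_k a_ik = 3`: no delocalisation without
share non-degeneracy (the `_false_without_ShareND` kernel of card 3; planar normals give `ipr_i ≥ 1`). -/
theorem reflectVel_coordinate (b : Fin 3) (v w : V3) :
    Literature.Analysis.FluidPDE.reflectVel (EuclideanSpace.single b (1 : ℝ)) (v, w) =
      (v - (v b - w b) • EuclideanSpace.single b (1 : ℝ),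
        w + (v b - w b) • EuclideanSpace.single b (1 : ℝ)) := by
  have hn : ‖(EuclideanSpace.single b (1 : ℝ) : V3)‖ = 1 := by simp
  have hin : ⟪v - w, (EuclideanSpace.single b (1 : ℝ) : V3)⟫_ℝ = v b - w b := by
    rw [EuclideanSpace.inner_single_right]
    simp
  simp only [Literature.Analysis.FluidPDE.reflectVel, hn, hin, one_pow, div_one]

/-- The swapped component, read off (PROVED): after a coordinate reflection particle `1` carries
particle `2`'s `b`-component and keeps its others. -/
theorem reflectVel_coordinate_apply (b c : Fin 3) (v w : V3) :
    (Literature.Analysis.FluidPDE.reflectVel (EuclideanSpace.single b (1 : ℝ)) (v, w)).1 c =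
      if c = b then w b else v c := by
  rw [reflectVel_coordinate]
  by_cases h : c = b
  · subst h; simp
  · simp [h]

/-- An abstract reflection history with coordinate normals: steps `(i, j, b)` act on velocity fields
`W : Fin n → V3` by `reflectVel (± e_b)` on the pair `(W i, W j)` (the sign is irrelevant:
`reflectVel_smul`). -/
def coordFold {n : ℕ} (L : List (Fin n × Fin n × Fin 3)) (W : Fin n → V3) : Fin n → V3 :=
  L.foldl
    (fun W' s =>
      Function.update
        (Function.update W' s.1
          (Literature.Analysis.FluidPDE.reflectVel (EuclideanSpace.single s.2.2 (1 : ℝ))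
            (W' s.1, W' s.2.1)).1)
        s.2.1
        (Literature.Analysis.FluidPDE.reflectVel (EuclideanSpace.single s.2.2 (1 : ℝ))
          (W' s.1, W' s.2.1)).2)
    W

/-- **No-split kernel (target of card 3; PROVED below as `coordinateNormalsNoSplit_holds`):** under coordinate normals every basis field is carried to a basis
field with the same component index, so for every particle `i` the participation
`Σ_k (Σ_a ‖(coordFold L (e_k ⊗ e_a)) i‖²)²` is at least `3` — it never delocalises, however long and
however "expanding" the collision sequence. -/
def CoordinateNormalsNoSplit : Prop :=
  ∀ (n : ℕ) (L : List (Fin n × Fin n × Fin 3)), (∀ s ∈ L, s.1 ≠ s.2.1) → ∀ i : Fin n,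
    (3 : ℝ) ≤ ∑ k : Fin n,
      (∑ a : Fin 3, ‖coordFold L (Pi.single k (EuclideanSpace.single a (1 : ℝ))) i‖ ^ 2) ^ 2

/-- Second component of a coordinate reflection (PROVED): particle `2` carries particle `1`'s
`b`-component and keeps its others. -/
theorem reflectVel_coordinate_apply_snd (b c : Fin 3) (v w : V3) :
    (Literature.Analysis.FluidPDE.reflectVel (EuclideanSpace.single b (1 : ℝ)) (v, w)).2 c =
      if c = b then v b else w c := by
  rw [reflectVel_coordinate]
  by_cases h : c = b
  · subst h; simp
  · simp [h]

/-- One step of the coordinate fold (the body of `coordFold`'s lambda). -/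
def coordStep {n : ℕ} (W : Fin n → V3) (s : Fin n × Fin n × Fin 3) : Fin n → V3 :=
  Function.update
    (Function.update W s.1
      (Literature.Analysis.FluidPDE.reflectVel (EuclideanSpace.single s.2.2 (1 : ℝ))
        (W s.1, W s.2.1)).1)
    s.2.1
    (Literature.Analysis.FluidPDE.reflectVel (EuclideanSpace.single s.2.2 (1 : ℝ))
      (W s.1, W s.2.1)).2

/-- `coordFold` is the left fold of `coordStep` (definitional). -/
theorem coordFold_eq_foldl {n : ℕ} (L : List (Fin n × Fin n × Fin 3)) (W : Fin n → V3) :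
    coordFold L W = L.foldl coordStep W := rfl

/-- The particle relabelling of one coordinate step seen by component `c`: the transposition of the
two endpoints if the step's normal is `e_c`, the identity otherwise. -/
def swapIf {n : ℕ} (s : Fin n × Fin n × Fin 3) (c : Fin 3) (i : Fin n) : Fin n :=
  if s.2.2 = c then Equiv.swap s.1 s.2.1 i else i

/-- A coordinate step permutes scalar coordinates (PROVED): component `c` of particle `i` afterwards is
component `c` of particle `swapIf s c i` before. -/
theorem coordStep_apply {n : ℕ} (W : Fin n → V3) (s : Fin n × Fin n × Fin 3) (hs : s.1 ≠ s.2.1)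
    (i : Fin n) (c : Fin 3) : coordStep W s i c = W (swapIf s c i) c := by
  obtain ⟨p, q, b⟩ := s
  simp only at hs
  unfold coordStep swapIf
  simp only
  by_cases hiq : i = q
  · subst hiq
    rw [Function.update_self, reflectVel_coordinate_apply_snd]
    by_cases hbc : b = c
    · subst hbc; simp
    · have hcb : c ≠ b := fun h => hbc h.symm
      simp [hbc, hcb]
  · rw [Function.update_of_ne hiq]
    by_cases hip : i = p
    · subst hip
      rw [Function.update_self, reflectVel_coordinate_apply]
      by_cases hbc : b = c
      · subst hbc; simp
      · have hcb : c ≠ b := fun h => hbc h.symm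
        simp [hbc, hcb]
    · rw [Function.update_of_ne hip]
      by_cases hbc : b = c
      · subst hbc; simp [Equiv.swap_apply_of_ne_of_ne hip hiq]
      · simp [hbc]

/-- The cumulative relabelling of a coordinate history seen by component `c`. -/
def permFold {n : ℕ} (c : Fin 3) : List (Fin n × Fin n × Fin 3) → Fin n → Fin n
  | [] => id
  | s :: L => fun i => swapIf s c (permFold c L i)

/-- A coordinate history permutes scalar coordinates (PROVED, induction on the history). -/
theorem coordFold_apply_eq {n : ℕ} (L : List (Fin n × Fin n × Fin 3))
    (hL : ∀ s ∈ L, s.1 ≠ s.2.1) (W : Fin n → V3) (i : Fin n) (c : Fin 3) :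
    coordFold L W i c = W (permFold c L i) c := by
  induction L generalizing W with
  | nil => rfl
  | cons s L ih =>
    have hs : s.1 ≠ s.2.1 := hL s (by simp)
    have hL' : ∀ s' ∈ L, s'.1 ≠ s'.2.1 := fun s' h => hL s' (by simp [h])
    show coordFold L (coordStep W s) i c = _
    rw [ih hL' (coordStep W s), coordStep_apply W s hs]
    rfl

/-- Basis fields go to basis fields (PROVED): the image at particle `i` of `e_k ⊗ e_a` has squared norm
`1` if component `a` of particle `i` is relabelled to `k`, and `0` otherwise. -/
theorem coordFold_single_norm_sq {n : ℕ} (L : List (Fin n × Fin n × Fin 3))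
    (hL : ∀ s ∈ L, s.1 ≠ s.2.1) (i k : Fin n) (a : Fin 3) :
    ‖coordFold L (Pi.single k (EuclideanSpace.single a (1 : ℝ))) i‖ ^ 2 =
      if permFold a L i = k then 1 else 0 := by
  rw [EuclideanSpace.real_norm_sq_eq]
  have hc : ∀ c : Fin 3, (coordFold L (Pi.single k (EuclideanSpace.single a (1 : ℝ))) i) c =
      if permFold c L i = k ∧ c = a then 1 else 0 := by
    intro c
    rw [coordFold_apply_eq L hL]
    by_cases h1 : permFold c L i = k
    · rw [h1, Pi.single_eq_same]
      by_cases h2 : c = a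
      · subst h2; simp
      · simp [h2]
    · rw [Pi.single_eq_of_ne h1]; simp [h1]
  simp_rw [hc]
  rw [Finset.sum_eq_single a]
  · by_cases h : permFold a L i = k <;> simp [h]
  · intro c _ hca; simp [hca]
  · intro h; exact absurd (Finset.mem_univ a) h

/-- A natural number is at most its square (as reals). -/
theorem natCast_le_sq (m : ℕ) : (m : ℝ) ≤ (m : ℝ) ^ 2 := by
  rcases Nat.eq_zero_or_pos m with h | h
  · simp [h]
  · have h1 : (1 : ℝ) ≤ m := by exact_mod_cast h
    nlinarith

/-- **The no-split kernel HOLDS (PROVED): `CoordinateNormalsNoSplit`.** Under coordinate normals the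
participation of every particle stays `≥ 3` — however long and expanding the collision history — so
share non-degeneracy (cards 1–2) is NECESSARY, not an artefact: the `_false_without_ShareND` theorem for
this crux's future `Disproof.lean`. -/
theorem coordinateNormalsNoSplit_holds : CoordinateNormalsNoSplit := by
  intro n L hL i
  have hf : ∀ k : Fin n,
      (∑ a : Fin 3, ‖coordFold L (Pi.single k (EuclideanSpace.single a (1 : ℝ))) i‖ ^ 2) =
        ((Finset.univ.filter (fun a : Fin 3 => permFold a L i = k)).card : ℝ) := by
    intro k
    simp_rw [coordFold_single_norm_sq L hL]
    rw [Finset.sum_boole]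
  have hsum : ∑ k : Fin n, ((Finset.univ.filter (fun a : Fin 3 => permFold a L i = k)).card : ℝ) = 3 := by
    simp_rw [Finset.card_filter]
    push_cast
    rw [Finset.sum_comm]
    simp
  simp only [hf]
  calc (3 : ℝ) = ∑ k : Fin n, ((Finset.univ.filter (fun a : Fin 3 => permFold a L i = k)).card : ℝ) :=
        hsum.symm
    _ ≤ ∑ k : Fin n, ((Finset.univ.filter (fun a : Fin 3 => permFold a L i = k)).card : ℝ) ^ 2 :=
        Finset.sum_le_sum fun k _ => natCast_le_sq _

/-- **Typed statics target of card `caged-stratum-pricing` (`TouchingPairsLD`).** Under the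
homogeneous (flow-invariant) Gibbs law `localGibbsLaw σ (a) (0) (θe)` the fraction of spheres having a
neighbour within gap `r·ε` of contact is super-exponentially unlikely to exceed `δ` as `r → 0`:
probability `≤ exp(−(N+1)(δ log(1/r) − C))`. A cage tight enough to keep a particle's normals
degenerate through an admissible window needs `r ≲ σ³/n_N → 0`, so `δN` caged particles cost
`≳ δN log n_N` nats — beyond the `O(N)` relative-entropy budget of any local Gibbs datum (entropy
inequality, Kipnis–Landim A1.8.2), which is how the line prices the structural exception of card 2. -/
def TouchingPairsLD : Prop :=
  ∀ (a θe : ℝ), 0 < a → 0 < θe → ∃ σ₀ : ℝ, 0 < σ₀ ∧ ∀ σ : ℝ, 0 < σ → σ < σ₀ →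
    ∀ δ : ℝ, 0 < δ → δ < 1 → ∃ C r₀ : ℝ, 0 < r₀ ∧ ∀ r : ℝ, 0 < r → r < r₀ → ∃ N₀ : ℕ, ∀ N : ℕ, N₀ ≤ N →
      ∀ Φ : Literature.Analysis.FluidPDE.HardSphereFlow
          (Literature.Analysis.FluidPDE.Torus.geometry (Fin 3))
          (Literature.MathematicalPhysics.KineticTheory.hsDiameter σ N) (N + 1),
        Literature.MathematicalPhysics.KineticTheory.localGibbsLaw σ (fun _ => a) (fun _ => 0)
            (fun _ => θe) N Φ
          {z | δ * ((N + 1 : ℕ) : ℝ) ≤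
            ((Finset.univ : Finset (Fin (N + 1))).filter (fun i => ∃ j : Fin (N + 1), j ≠ i ∧
              Literature.Analysis.FluidPDE.Torus.euclidDist (z i).1 (z j).1 ≤
                (1 + r) * Literature.MathematicalPhysics.KineticTheory.hsDiameter σ N)).card} ≤
          ENNReal.ofReal (Real.exp (-(((N + 1 : ℕ) : ℝ) * (δ * Real.log (1 / r) - C))))

end Cage

end

end Summit.AtomisticToContinuum.HydrodynamicLimit.Cruxes.DiffuseBackwardInfluence.IdeatorOneG2
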